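import Mathlib
import Summits.Ventures.DiscreteObjects.MOLS.PairArrayOA

/-!
# From an array automorphism with coordinate part `(0 1)(2 3)` to the self-orthogonal normal form

Cell `pub-namedobj`, family SOLS. Framing: lottery ticket; floor = certified bounds/negative ranges.
Glue between the array language (`IsArrayAut`, `pairArray` — PairArrayRigidity/PairArrayOA) and the
square language (`IsSwapAut`, `swapSquare` — SelfOrthogonalPairs): an automorphism of the pair array
of `(A, B)` whose coordinate permutation is the swap `(0 1)(2 3)` (rows ↔ columns, `A`-symbols ↔
`B`-symbols) is a swap automorphism of the squares (`isSwapAut_of_arrayAut`); hence, if `A` is rigid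
(no non-trivial autotopism — [MMM 2007] at order 10), `L := swapSquare A (φ 0)` is SELF-ORTHOGONAL and
a square is a common orthogonal mate of `A, B` iff its column-relabelling is one of `L, Lᵀ`
(`selfOrthogonal_normal_form_of_arrayAut`). Together with `arrayAut_eq_one_of_fix` (automorphisms
fixing a coordinate are trivial on rigid data) and `fin4_derangement_sq` (a fixed-point-free
permutation of four coordinates has the swap type `2+2` itself or as its square, up to renaming the
coordinates) this is the census reduction of FAMILY-SOLS §1, kernel-checked modulo [MMM 2007].
-/

namespace Summit.Ventures.DiscreteObjects.MOLS

variable {α : Type*}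

/-- The coordinate swap `(0 1)(2 3)` of a pair array: rows ↔ columns, `A`-symbols ↔ `B`-symbols. -/
def swap0123 : Equiv.Perm (Fin 4) := Equiv.swap 0 1 * Equiv.swap 2 3

/-- `swap0123` is an involution. -/
theorem swap0123_symm : swap0123.symm = swap0123 := by decide

/-- values of `swap0123`. -/
theorem swap0123_apply :
    swap0123 0 = 1 ∧ swap0123 1 = 0 ∧ swap0123 2 = 3 ∧ swap0123 3 = 2 := by decide

/-- The acted row of the cell `(x, y)` under `(swap0123, φ)` is
`(φ 1 y, φ 0 x, φ 3 (B x y), φ 2 (A x y))`. -/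
theorem act_swap_prow (A B : α → α → α) (φ : Fin 4 → Equiv.Perm α) (x y : α) :
    act swap0123 φ (prow A B x y) = ![φ 1 y, φ 0 x, φ 3 (B x y), φ 2 (A x y)] := by
  obtain ⟨h0, h1, h2, h3⟩ := swap0123_apply
  funext j
  fin_cases j
  · show φ (swap0123.symm 0) (prow A B x y (swap0123.symm 0)) = _
    rw [swap0123_symm, h0]; rfl
  · show φ (swap0123.symm 1) (prow A B x y (swap0123.symm 1)) = _
    rw [swap0123_symm, h1]; rfl
  · show φ (swap0123.symm 2) (prow A B x y (swap0123.symm 2)) = _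
    rw [swap0123_symm, h2]; rfl
  · show φ (swap0123.symm 3) (prow A B x y (swap0123.symm 3)) = _
    rw [swap0123_symm, h3]; rfl

/-- **Array automorphism ⇒ swap automorphism of the squares.** If `(swap0123, φ)` maps the pair array
of `(A, B)` into itself then `(φ 0, φ 1, φ 2, φ 3)` is a swap automorphism in the sense of
`IsSwapAut`: the cell `(φ 1 y, φ 0 x)` carries `A = φ 3 (B x y)` and `B = φ 2 (A x y)`. -/
theorem isSwapAut_of_arrayAut {A B : α → α → α} {φ : Fin 4 → Equiv.Perm α}
    (h : ∀ t ∈ pairArray A B, act swap0123 φ t ∈ pairArray A B) :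
    IsSwapAut A B (φ 0) (φ 1) (φ 2) (φ 3) := by
  intro x y
  have hmem := h (prow A B x y) ⟨(x, y), rfl⟩
  rw [act_swap_prow] at hmem
  obtain ⟨x', y', hrow⟩ := mem_pairArray.1 hmem
  have e0 := congrFun hrow 0
  have e1 := congrFun hrow 1
  have e2 := congrFun hrow 2
  have e3 := congrFun hrow 3
  simp only [prow_zero, prow_one, prow_two, prow_three, Matrix.cons_val_zero, Matrix.cons_val_one] at e0 e1 e2 e3
  -- e0 : φ 1 y = x', e1 : φ 0 x = y', e2 : φ 3 (B x y) = A x' y', e3 : φ 2 (A x y) = B x' y'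
  refine ⟨?_, ?_⟩
  · rw [e0, e1]; exact e2.symm
  · rw [e0, e1]; exact e3.symm

/-- **The census reduction, assembled.** Let `A ⟂ B` be squares whose pair array has an automorphism
with coordinate part `(0 1)(2 3)` and suppose `A` is rigid (only the trivial autotopism). Then with
`L := swapSquare A (φ 0)`: `L` is orthogonal to its transpose, and a square `M` is orthogonal to both
`A` and `B` iff `M` with columns relabelled by `φ 0` is orthogonal to both `L` and `Lᵀ`. -/
theorem selfOrthogonal_normal_form_of_arrayAut {A B : α → α → α} {φ : Fin 4 → Equiv.Perm α}
    (hAB : Orthogonal A B) (haut : IsArrayAut (pairArray A B) swap0123 φ)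
    (rigid : ∀ r c s : Equiv.Perm α, IsAutotopism A r c s → r = 1 ∧ c = 1 ∧ s = 1) :
    Orthogonal (swapSquare A (φ 0)) (fun x y => swapSquare A (φ 0) y x) ∧
      ∀ M : α → α → α, (Orthogonal M A ∧ Orthogonal M B) ↔
        (Orthogonal (fun x y => M x (φ 0 y)) (swapSquare A (φ 0)) ∧
          Orthogonal (fun x y => M x (φ 0 y)) (fun x y => swapSquare A (φ 0) y x)) := by
  have hsw : IsSwapAut A B (φ 0) (φ 1) (φ 2) (φ 3) :=
    isSwapAut_of_arrayAut (fun t ht => (haut t).1 ht)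
  obtain ⟨h1, h3⟩ := swapAut_involutive_of_rigid hsw rigid
  rw [h1, h3] at hsw
  exact ⟨selfOrthogonal_of_swapAut hAB hsw, fun M => extends_iff_of_swapAut hsw M⟩

end Summit.Ventures.DiscreteObjects.MOLS
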